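import Summits.CriticalPhenomena.PercolationContinuityZ3.Theorems.PercNearOneGluingNoHeavyLowerTailStarSetFamilyReg
import HarnessLib

/-!
# `NoHeavyLowerTail` (stmt-CriticalPhenomena-4575) — the regular family from the unit data (U1-PROOF §3 A1/A2; blueprint §G5)

Support file (prover `prim-gen-swap` gen 13; `--supports stmt-CriticalPhenomena-4575`).  No definitions, no named facts, no sorries.

Discharges `familyReg_bound` from the ASSEMBLY's definition of a regular unit (blueprint §G5): a unit `(S, X)` (`X ∈ S` an r-free chord adjacent to
every class of `S`) with a partner `Y ∈ S ∖ {X}`, `Y ∌ r`, such that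
R1: `X` is not hot at its free end `p` (the port of `X` outside `Y`): `r ∉ dom X p`; or
R2: `Y ∉ F` and `Y` is not hot at its free end `s` (the port of `Y` outside `X`): `r ∉ dom Y s`.
Then `(M, E₁, E₂) = (X, Y, dom X p)` resp. `(Y, X, dom Y s)` is a regular triple (`hdom`: the dominator lies in `F`, passes through the end, its other port
avoids the dominated class, and it is heavier), so `Σ_{u∈U} W(S_u) ≤ (1/2)·Σ_{T regular triple} C_T`.
(No `[Fintype V]` here: with it the filter predicate below would pick the constructive `Decidable` instance and membership proofs time out.)

* `StarSet.other_port`, `StarSet.adj_common_port` — port bookkeeping;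
* `StarSet.familyReg_of_units`.
-/

namespace Summit.CriticalPhenomena.PercolationContinuityZ3.Theorems

open Finset
open scoped BigOperators Classical

namespace StarSet

variable {ι V : Type*} [Fintype ι] [DecidableEq ι] [DecidableEq V]

omit [Fintype ι] [DecidableEq ι] [DecidableEq V] in
/-- The other port of a class through `x`. -/
theorem other_port (P P' : ι → V) (hPP' : ∀ X, P X ≠ P' X) {K : ι} {x : V} (hx : P K = x ∨ P' K = x) :
    ∃ o, o ≠ x ∧ (P K = o ∨ P' K = o) ∧ (s(P K, P' K) : Sym2 V) = s(x, o) ∧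
      ∀ w, (P K = w ∨ P' K = w) → w = x ∨ w = o := by
  rcases hx with h | h
  · refine ⟨P' K, by rw [← h]; exact (hPP' K).symm, Or.inr rfl, by rw [h], fun w hw => ?_⟩
    rcases hw with hw | hw
    · exact Or.inl (h.symm.trans hw).symm
    · exact Or.inr hw.symm
  · refine ⟨P K, by rw [← h]; exact hPP' K, Or.inl rfl, by rw [← h]; exact Sym2.eq_swap, fun w hw => ?_⟩
    rcases hw with hw | hw
    · exact Or.inr hw.symm
    · exact Or.inl (h.symm.trans hw).symm

omit [Fintype ι] [DecidableEq ι] [DecidableEq V] in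
/-- Adjacent classes have a common port. -/
theorem adj_common_port (P P' : ι → V) {X Y : ι} (h : P Y = P X ∨ P Y = P' X ∨ P' Y = P X ∨ P' Y = P' X) :
    ∃ w, (P Y = w ∨ P' Y = w) ∧ (P X = w ∨ P' X = w) := by
  rcases h with h | h | h | h
  · exact ⟨P Y, Or.inl rfl, Or.inl h.symm⟩
  · exact ⟨P Y, Or.inl rfl, Or.inr h.symm⟩
  · exact ⟨P' Y, Or.inr rfl, Or.inl h.symm⟩
  · exact ⟨P' Y, Or.inr rfl, Or.inr h.symm⟩

/-- **The regular family from the unit data (blueprint §G5).** -/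
theorem familyReg_of_units (P P' : ι → V) (hPP' : ∀ X, P X ≠ P' X) (r : V) (F : Finset ι)
    (θ : ι → ℝ) (hθ0 : ∀ X, 0 ≤ θ X) (hθ1 : ∀ X, θ X ≤ 1) (O : ι → V → ℝ) (hO0 : ∀ X d, 0 ≤ O X d) (Φ : ι → ℝ)
    (hO2 : ∀ X, Φ X ^ 2 ≤ O X (P X) * O X (P' X)) (hΦ4 : ∀ X, 4 * θ X ≤ Φ X) (hΦsq : ∀ X, θ X ≤ Φ X ^ 2)
    (dom : ι → V → ι)
    (hdom : ∀ X ∉ F, ∀ d, (P X = d ∨ P' X = d) →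
      dom X d ∈ F ∧ (P (dom X d) = d ∨ P' (dom X d) = d) ∧
        (∀ u, (P (dom X d) = u ∨ P' (dom X d) = u) → (P X = u ∨ P' X = u) → u = d) ∧ θ X ≤ θ (dom X d))
    (U : Finset (Finset ι × ι))
    (hU : ∀ u ∈ U, u.2 ∈ u.1 ∧ u.2 ∉ F ∧ P u.2 ≠ r ∧ P' u.2 ≠ r ∧
      (∀ Y ∈ u.1, P Y = P u.2 ∨ P Y = P' u.2 ∨ P' Y = P u.2 ∨ P' Y = P' u.2) ∧
      ∃ Y ∈ u.1, Y ≠ u.2 ∧ P Y ≠ r ∧ P' Y ≠ r ∧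
        ((∃ p, (P u.2 = p ∨ P' u.2 = p) ∧ P Y ≠ p ∧ P' Y ≠ p ∧ P (dom u.2 p) ≠ r ∧ P' (dom u.2 p) ≠ r) ∨
         (Y ∉ F ∧ ∃ s', (P Y = s' ∨ P' Y = s') ∧ P u.2 ≠ s' ∧ P' u.2 ≠ s' ∧ P (dom Y s') ≠ r ∧ P' (dom Y s') ≠ r))) :
    ∑ u ∈ U, ((∏ k ∈ u.1, θ k) * ∏ k ∈ univ \ u.1, (1 - θ k)) ≤
      (1 / 2) * ∑ T ∈ (univ : Finset ι).powerset.filter (fun T => ∃ M E₁ E₂ : ι, ∃ q₁ q₂ f₁ f₂ : V,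
          M ∉ F ∧ (s(P M, P' M) : Sym2 V) = s(q₁, q₂) ∧ (s(P E₁, P' E₁) : Sym2 V) = s(q₁, f₁) ∧
          (s(P E₂, P' E₂) : Sym2 V) = s(q₂, f₂) ∧ q₁ ≠ q₂ ∧ f₁ ≠ q₁ ∧ f₁ ≠ q₂ ∧ f₂ ≠ q₁ ∧ f₂ ≠ q₂ ∧
          q₁ ≠ r ∧ q₂ ≠ r ∧ f₁ ≠ r ∧ f₂ ≠ r ∧ T = {M, E₁, E₂}),
        ∑ δ ∈ (univ : Finset (ι → Bool)).filter (fun δ => (∀ K ∉ T, δ K = false) ∧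
            3 ≤ (T.image fun K => if δ K then P K else P' K).card ∧ r ∉ T.image fun K => if δ K then P K else P' K),
          ∏ K ∈ T, O K (if δ K then P K else P' K) := by
  refine familyReg_bound P P' r F θ hθ0 hθ1 O hO0 Φ hO2 hΦ4 hΦsq _
    (fun T hT => mem_filter.2 ⟨mem_powerset.2 (subset_univ _), hT⟩) U fun u hu => ?_
  obtain ⟨hXS, hXF, hXr, hX'r, hadj, Y, hYS, hYX, hYr, hY'r, hcase⟩ := hU u hu
  refine ⟨hXS, hXF, ?_⟩
  -- ports of the hub avoid `r`
  have hXnr : ∀ w, (P u.2 = w ∨ P' u.2 = w) → w ≠ r := by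
    rintro w (h | h) <;> rw [← h]
    · exact hXr
    · exact hX'r
  have hYnr : ∀ w, (P Y = w ∨ P' Y = w) → w ≠ r := by
    rintro w (h | h) <;> rw [← h]
    · exact hYr
    · exact hY'r
  rcases hcase with ⟨p, hXp, hYp, hY'p, hNr, hN'r⟩ | ⟨hYF, s', hYs', hXs', hX's', hNr, hN'r⟩
  · -- R1: M = X, E₁ = Y, E₂ = dom X p
    obtain ⟨q, hqp, hXq, hXpair, hXports⟩ := other_port P P' hPP' hXp
    -- `Y ∋ q`
    have hYq : P Y = q ∨ P' Y = q := by
      obtain ⟨w, hYw, hXw⟩ := adj_common_port P P' (hadj Y hYS)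
      rcases hXports w hXw with rfl | rfl
      · rcases hYw with h | h
        · exact absurd h hYp
        · exact absurd h hY'p
      · exact hYw
    obtain ⟨s, hsq, hYs, hYpair, -⟩ := other_port P P' hPP' hYq
    obtain ⟨hNF, hNp, hNX, hθN⟩ := hdom u.2 hXF p hXp
    obtain ⟨f₂, hf₂p, hNf₂, hNpair, -⟩ := other_port P P' hPP' hNp
    have hsp : s ≠ p := by
      rintro rfl
      rcases hYs with h | h
      · exact hYp h
      · exact hY'p h
    have hf₂q : f₂ ≠ q := by
      rintro rfl
      exact hqp (hNX _ hNf₂ hXq)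
    refine ⟨u.2, Y, dom u.2 p, q, p, s, f₂, hXF, ?_, hYpair, hNpair, hqp, hsq, hsp, hf₂q, hf₂p,
      hXnr q hXq, hXnr p hXp, hYnr s hYs, ?_, hXS, hYS, hNF, Or.inl rfl, Or.inl hθN⟩
    · rw [hXpair]; exact Sym2.eq_swap
    · rcases hNf₂ with h | h
      · rw [← h]; exact hNr
      · rw [← h]; exact hN'r
  · -- R2: M = Y, E₁ = X, E₂ = dom Y s'
    obtain ⟨q, hqs', hYq, hYpair, hYports⟩ := other_port P P' hPP' hYs'
    -- `X ∋ q`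
    have hXq : P u.2 = q ∨ P' u.2 = q := by
      obtain ⟨w, hYw, hXw⟩ := adj_common_port P P' (hadj Y hYS)
      rcases hYports w hYw with rfl | rfl
      · rcases hXw with h | h
        · exact absurd h hXs'
        · exact absurd h hX's'
      · exact hXw
    obtain ⟨p, hpq, hXp, hXpair, -⟩ := other_port P P' hPP' hXq
    obtain ⟨hNF, hNs', hNY, hθN⟩ := hdom Y hYF s' hYs'
    obtain ⟨f₂, hf₂s', hNf₂, hNpair, -⟩ := other_port P P' hPP' hNs'
    have hps' : p ≠ s' := by
      rintro rfl
      rcases hXp with h | h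
      · exact hXs' h
      · exact hX's' h
    have hf₂q : f₂ ≠ q := by
      rintro rfl
      exact hqs' (hNY _ hNf₂ hYq)
    refine ⟨Y, u.2, dom Y s', q, s', p, f₂, hYF, ?_, hXpair, hNpair, hqs', hpq, hps', hf₂q, hf₂s',
      hYnr q hYq, hYnr s' hYs', hXnr p hXp, ?_, hYS, hXS, hNF, Or.inr rfl, Or.inl hθN⟩
    · rw [hYpair]; exact Sym2.eq_swap
    · rcases hNf₂ with h | h
      · rw [← h]; exact hNr
      · rw [← h]; exact hN'r

end StarSet

end Summit.CriticalPhenomena.PercolationContinuityZ3.Theorems
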